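import Summits.Ventures.HodgeRepro.Night4ReducedDimQuadTable
import Summits.Ventures.HodgeRepro.Night4ReducedDimTwelveNonabelian

/-!
# Beyond the census faces in degree 12: the complete table of the dicyclic group `Dic3`

Blind re-derivation cell `pub-hodge-repro`, seat `night-4` (ROUTE HARDENING for the Monday FINAL, gen 6).  Target tree
path `lean/Summits/Ventures/HodgeRepro/Night4ReducedDimQuadDic3.lean`.

ROUTE.md v2.89 §3.4 tabulates `dim B_red` for the CENSUS faces of degree 12 and counts the non-census conjugate-free
`SumTwo` quadruples (patterns `(3,2,1)`, `(2,2,2)`; §3.1) without tabulating them.  This file puts the COMPLETE table of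
the dicyclic group `Dic3` on the kernel — `dim B_red` of EVERY conjugate-free `SumTwo` quadruple of CM types, census
faces and non-census classes alike — by the method of `Night4ReducedDimQuadTable.lean`: the base corner runs over the
4 representatives of the double classes `{g · Φ · h}` of CM types (`night4Bases_Dic3`, the cover `night4Bases_Dic3_cover`
KERNEL), the second corner over all 64 CM types (`night4AllTypes_Dic3`), the third over the `2^{|T₀ \ T₁|}` corners
compatible with `SumTwo`, the fourth is forced; one `decide +kernel` row per representative (`night4QuadRow_Dic3_*`).

* **`redDim_sumTwo_Dic3`**: `dim B_red ∈ [8, 12, 14, 18, 20, 24]` on every conjugate-free `SumTwo` quadruple, every value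
  attained (`night4QuadAttained_Dic3_*`, explicit kernel witnesses); **`eight_le_redDim_sumTwo_Dic3`**;
  **`degSixShape_of_lt_nine_Dic3`**: below the census minimum 9 every such quadruple has the degree-6 shape (pattern
  `(2,2,2)`, three corners right translates of one type, the fourth lifted from a subfield of degree ≤ 4) — so the values
  8 below 9 are S₂ × A₆ products, as the witnesses of `Night4ReducedDimQuadWitnesses.lean`
  show, and the census ninefolds of §3.5 (i) are NOT the smallest objects of degree 12 beyond the census (they are the
  smallest census faces).

The Python census of gen 5 (proofs/night-4/g5/quads12.py) found the same value set; here it is a kernel theorem.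
Nothing here says anything about the status of the Hodge conjecture for CM abelian varieties, which is NOT proved.
-/

set_option autoImplicit false

open Finset
open scoped Pointwise

namespace HodgeRepro

/-! ## the dicyclic group `Dic3`: the types, the key, the representatives of the double classes -/

/-- The encoding of `Dic3` used by the key: `a i ↦ i`, `xa i ↦ 6 + i`. -/
def night4Enc_Dic3 : Dic3 → ℕ
  | QuaternionGroup.a i => i.val
  | QuaternionGroup.xa i => 6 + i.val

/-- All 64 CM types of `(Dic3, cc_Dic3)`: the 32 containing `1` (gen 5) and their conjugates. -/
def night4AllTypes_Dic3 : List (Finset Dic3) := night4Types_Dic3 ++ night4Types_Dic3.map (cc_Dic3 • ·)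

/-- Every CM type of `(Dic3, cc_Dic3)` is in the list. -/
theorem night4AllTypes_Dic3_cover : ∀ Φ : Finset Dic3, IsCMType cc_Dic3 Φ → Φ ∈ night4AllTypes_Dic3 :=
  mem_types_of_cover cc_Dic3_isComplexConj night4Types_Dic3 night4Types_Dic3_cover

/-- The key sorting the corners: the subset as a binary number. -/
def night4Key_Dic3 (S : Finset Dic3) : ℕ := S.sum fun g => 2 ^ night4Enc_Dic3 g

/-- The 4 representatives of the double classes `{g · Φ · h}` of the CM types of `(Dic3, cc_Dic3)`
(orbit sizes 36, 12, 12, 4). -/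
def night4Bases_Dic3 : List (Finset Dic3) :=
  [night4Type_Dic3 [0, 1, 2] [0, 1, 2],
    night4Type_Dic3 [0, 2, 4] [0, 1, 2],
    night4Type_Dic3 [1, 3, 5] [0, 1, 2],
    night4Type_Dic3 [0, 2, 4] [0, 2, 4]]

/-- Every CM type of `(Dic3, cc_Dic3)` is a twist of a Galois translate of a representative.  KERNEL (the 64 types,
the 144 pairs `(g, h)`). -/
theorem night4Bases_Dic3_all :
    (night4AllTypes_Dic3.all fun Φ => decide (∃ g h : Dic3, rmul (g • Φ) h ∈ night4Bases_Dic3)) = true := by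
  decide +kernel

/-- The double-class cover of `(Dic3, cc_Dic3)`. -/
theorem night4Bases_Dic3_cover :
    ∀ Φ : Finset Dic3, IsCMType cc_Dic3 Φ → ∃ g h : Dic3, rmul (g • Φ) h ∈ night4Bases_Dic3 :=
  bases_cover_of_all _ _ night4AllTypes_Dic3_cover night4Bases_Dic3_all

/-- The value set of `dim B_red` on the conjugate-free `SumTwo` quadruples of `(Dic3, cc_Dic3)`. -/
def night4QuadVals_Dic3 : List ℕ := [8, 12, 14, 18, 20, 24]

/-! ## The rows — KERNEL, one `decide` per representative -/

/-- Row 0: the base corner `night4Type_Dic3 [0, 1, 2] [0, 1, 2]`. -/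
theorem night4QuadRow_Dic3_0 : quadRow cc_Dic3 night4Key_Dic3 (night4QuadPred night4QuadVals_Dic3)
    night4AllTypes_Dic3 (night4Type_Dic3 [0, 1, 2] [0, 1, 2]) = true := by
  decide +kernel

/-- Row 1: the base corner `night4Type_Dic3 [0, 2, 4] [0, 1, 2]`. -/
theorem night4QuadRow_Dic3_1 : quadRow cc_Dic3 night4Key_Dic3 (night4QuadPred night4QuadVals_Dic3)
    night4AllTypes_Dic3 (night4Type_Dic3 [0, 2, 4] [0, 1, 2]) = true := by
  decide +kernel

/-- Row 2: the base corner `night4Type_Dic3 [1, 3, 5] [0, 1, 2]`. -/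
theorem night4QuadRow_Dic3_2 : quadRow cc_Dic3 night4Key_Dic3 (night4QuadPred night4QuadVals_Dic3)
    night4AllTypes_Dic3 (night4Type_Dic3 [1, 3, 5] [0, 1, 2]) = true := by
  decide +kernel

/-- Row 3: the base corner `night4Type_Dic3 [0, 2, 4] [0, 2, 4]`. -/
theorem night4QuadRow_Dic3_3 : quadRow cc_Dic3 night4Key_Dic3 (night4QuadPred night4QuadVals_Dic3)
    night4AllTypes_Dic3 (night4Type_Dic3 [0, 2, 4] [0, 2, 4]) = true := by
  decide +kernel

/-- The table of `(Dic3, cc_Dic3)`: the 4 rows. -/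
theorem night4QuadTable_Dic3 : quadTableP cc_Dic3 night4Key_Dic3 (night4QuadPred night4QuadVals_Dic3) night4Bases_Dic3
    night4AllTypes_Dic3 = true := by
  simp only [quadTableP, night4Bases_Dic3, List.all_cons, List.all_nil, night4QuadRow_Dic3_0, night4QuadRow_Dic3_1, night4QuadRow_Dic3_2, night4QuadRow_Dic3_3, Bool.and_self]

/-! ## The theorems -/

/-- **Every conjugate-free `SumTwo` quadruple of CM types of `(Dic3, cc_Dic3)` has `dim B_red ∈ [8, 12, 14, 18, 20, 24]`, and
the degree-6 shape below 9.**  KERNEL, through `night4Quad_of_table`. -/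
theorem night4Quad_Dic3 (T : Fin 4 → Finset Dic3) (hT : ∀ i, IsCMType cc_Dic3 (T i)) (hsum : SumTwo T)
    (hconj : ConjFree cc_Dic3 T) : redDim T ∈ night4QuadVals_Dic3 ∧ (redDim T < 9 → DegSixShape T) :=
  night4Quad_of_table cc_Dic3_isComplexConj _ _ night4Bases_Dic3_cover night4AllTypes_Dic3_cover night4Key_Dic3 _
    night4QuadTable_Dic3 T hT hsum hconj

/-- **The complete value set of `(Dic3, cc_Dic3)`**: `dim B_red ∈ [8, 12, 14, 18, 20, 24]` on every
conjugate-free `SumTwo` quadruple of CM types (census faces and non-census classes alike). -/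
theorem redDim_sumTwo_Dic3 (T : Fin 4 → Finset Dic3) (hT : ∀ i, IsCMType cc_Dic3 (T i)) (hsum : SumTwo T)
    (hconj : ConjFree cc_Dic3 T) : redDim T ∈ [8, 12, 14, 18, 20, 24] :=
  (night4Quad_Dic3 T hT hsum hconj).1

/-- `8 ≤ dim B_red` on every conjugate-free `SumTwo` quadruple of `(Dic3, cc_Dic3)`. -/
theorem eight_le_redDim_sumTwo_Dic3 (T : Fin 4 → Finset Dic3) (hT : ∀ i, IsCMType cc_Dic3 (T i)) (hsum : SumTwo T)
    (hconj : ConjFree cc_Dic3 T) : 8 ≤ redDim T := by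
  have h := redDim_sumTwo_Dic3 T hT hsum hconj
  simp only [List.mem_cons, List.not_mem_nil, or_false] at h
  omega

/-- **Below the census minimum, the degree-6 shape**: a conjugate-free `SumTwo` quadruple of `(Dic3, cc_Dic3)` with
`dim B_red < 9` has all pairwise intersections of size 2, three corners right translates of one type and the fourth lifted
from a subfield of degree ≤ 4. -/
theorem degSixShape_of_lt_nine_Dic3 (T : Fin 4 → Finset Dic3) (hT : ∀ i, IsCMType cc_Dic3 (T i)) (hsum : SumTwo T)
    (hconj : ConjFree cc_Dic3 T) (h : redDim T < 9) : DegSixShape T :=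
  (night4Quad_Dic3 T hT hsum hconj).2 h

/-- The values of `(Dic3, cc_Dic3)` below the census minimum are exactly 8. -/
theorem redDim_sumTwo_Dic3_lt_nine_iff (T : Fin 4 → Finset Dic3) (hT : ∀ i, IsCMType cc_Dic3 (T i)) (hsum : SumTwo T)
    (hconj : ConjFree cc_Dic3 T) : redDim T < 9 ↔ redDim T = 8 := by
  have h := redDim_sumTwo_Dic3 T hT hsum hconj
  simp only [List.mem_cons, List.not_mem_nil, or_false] at h
  omega

/-! ## Every value attained — explicit quadruples, KERNEL -/

/-- The value 8 is attained on `(Dic3, cc_Dic3)`. -/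
theorem night4QuadAttained_Dic3_8 : ∃ T : Fin 4 → Finset Dic3, (∀ i, IsCMType cc_Dic3 (T i)) ∧ SumTwo T ∧
    ConjFree cc_Dic3 T ∧ redDim T = 8 :=
  ⟨![night4Type_Dic3 [0, 1, 2] [0, 1, 2], night4Type_Dic3 [2, 3, 4] [2, 3, 4], night4Type_Dic3 [1, 3, 5] [1, 3, 5], night4Type_Dic3 [0, 4, 5] [0, 4, 5]],
    by decide +kernel, by decide +kernel, by decide +kernel, by rw [redDim_eq_redDimFirst]; decide +kernel⟩

/-- The value 12 is attained on `(Dic3, cc_Dic3)`. -/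
theorem night4QuadAttained_Dic3_12 : ∃ T : Fin 4 → Finset Dic3, (∀ i, IsCMType cc_Dic3 (T i)) ∧ SumTwo T ∧
    ConjFree cc_Dic3 T ∧ redDim T = 12 :=
  ⟨![night4Type_Dic3 [0, 1, 2] [0, 1, 2], night4Type_Dic3 [3, 4, 5] [0, 1, 2], night4Type_Dic3 [1, 2, 3] [3, 4, 5], night4Type_Dic3 [0, 4, 5] [3, 4, 5]],
    by decide +kernel, by decide +kernel, by decide +kernel, by rw [redDim_eq_redDimFirst]; decide +kernel⟩

/-- The value 14 is attained on `(Dic3, cc_Dic3)`. -/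
theorem night4QuadAttained_Dic3_14 : ∃ T : Fin 4 → Finset Dic3, (∀ i, IsCMType cc_Dic3 (T i)) ∧ SumTwo T ∧
    ConjFree cc_Dic3 T ∧ redDim T = 14 :=
  ⟨![night4Type_Dic3 [0, 1, 2] [0, 1, 2], night4Type_Dic3 [1, 3, 5] [0, 2, 4], night4Type_Dic3 [3, 4, 5] [1, 3, 5], night4Type_Dic3 [0, 2, 4] [3, 4, 5]],
    by decide +kernel, by decide +kernel, by decide +kernel, by rw [redDim_eq_redDimFirst]; decide +kernel⟩

/-- The value 18 is attained on `(Dic3, cc_Dic3)`. -/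
theorem night4QuadAttained_Dic3_18 : ∃ T : Fin 4 → Finset Dic3, (∀ i, IsCMType cc_Dic3 (T i)) ∧ SumTwo T ∧
    ConjFree cc_Dic3 T ∧ redDim T = 18 :=
  ⟨![night4Type_Dic3 [0, 1, 2] [0, 1, 2], night4Type_Dic3 [3, 4, 5] [0, 1, 2], night4Type_Dic3 [0, 2, 4] [3, 4, 5], night4Type_Dic3 [1, 3, 5] [3, 4, 5]],
    by decide +kernel, by decide +kernel, by decide +kernel, by rw [redDim_eq_redDimFirst]; decide +kernel⟩

/-- The value 20 is attained on `(Dic3, cc_Dic3)`. -/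
theorem night4QuadAttained_Dic3_20 : ∃ T : Fin 4 → Finset Dic3, (∀ i, IsCMType cc_Dic3 (T i)) ∧ SumTwo T ∧
    ConjFree cc_Dic3 T ∧ redDim T = 20 :=
  ⟨![night4Type_Dic3 [0, 1, 2] [0, 1, 2], night4Type_Dic3 [0, 2, 4] [0, 2, 4], night4Type_Dic3 [3, 4, 5] [1, 3, 5], night4Type_Dic3 [1, 3, 5] [3, 4, 5]],
    by decide +kernel, by decide +kernel, by decide +kernel, by rw [redDim_eq_redDimFirst]; decide +kernel⟩

/-- The value 24 is attained on `(Dic3, cc_Dic3)`. -/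
theorem night4QuadAttained_Dic3_24 : ∃ T : Fin 4 → Finset Dic3, (∀ i, IsCMType cc_Dic3 (T i)) ∧ SumTwo T ∧
    ConjFree cc_Dic3 T ∧ redDim T = 24 :=
  ⟨![night4Type_Dic3 [0, 1, 2] [0, 1, 2], night4Type_Dic3 [2, 3, 4] [0, 1, 2], night4Type_Dic3 [1, 3, 5] [3, 4, 5], night4Type_Dic3 [0, 4, 5] [3, 4, 5]],
    by decide +kernel, by decide +kernel, by decide +kernel, by rw [redDim_eq_redDimFirst]; decide +kernel⟩

end HodgeRepro
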